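/-
Copyright: harness cell b2b-lgcu-borel (gen 26).  Honest framing: the VALUE here is a THEOREM
(a NEGATIVE verdict on an infinite slice of the crux: every dimension `m ≥ 3`, the primes
`11 ≤ p ≤ 43`, below an explicit `ε(p)`) — NOT summit progress; the crux item
`SubgroupIdentityDesigns` (stmt-MatrixMultiplication-14079) stays open and untouched.
-/
import Mathlib
import Literature.Barriers.RiemannHypothesis.EpsteinZetaRealZerosIntegralWitness
import Summits.MatrixMultiplication.MatrixMultiplication.Theorems.SubgroupIdentityDesigns.Negative.LevelOneEpsilonFloor
import Summits.MatrixMultiplication.MatrixMultiplication.Theorems.SubgroupIdentityDesigns.Negative.LevelOneNeumannSqueeze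

/-!
# A linear certificate: no level-one witness below `ε_F(p)`, in EVERY dimension `m ≥ 3`

Route `LevelGradedCohnUmans`, crux `SubgroupIdentityDesigns` (OPEN, untouched).  This file
sharpens the in-tree all-dimension threshold `ε_N(p)` of `LevelOneNeumannSqueeze`
(`p^{ε/2} ≤ (5/2)^{(2+ε)/3}`, i.e. `ε_N(11) ≈ 0.684`, `ε_N(13) ≈ 0.625`, `ε_N(23) ≈ 0.484`,
`ε_N(43) ≈ 0.388`) by keeping the exact floor exponent and replacing the power-mean step by a
certificate that is LINEAR in `b = (p^{1+l} − 1)/(p − 1)` and therefore uniform in the dimension.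

The chain for a level-one witness `(H₁,H₂,H₃)` in `GL_{1+l}(𝔽_p)` at exponent `ε`, any real
`t ≥ 2 + ε` (`V = |H₁||H₂||H₃|`, `D = dim`, `D ≤ (p − 1) b² − 2 b + 2`):
* `floor_exp`:  `1 + (b − 1)^t + (p − 2) b^t < V^{t/3}`;
* `crux_volume_law` + `law_ceiling` + `ceiling_mono`:  `V ≤ 2 ((√((p−1)b² − 2b + 2) + 1/2)/√3)³`;
* (`uniform_master`) hence
  `1 + (b − 1)^t + (p − 2) b^t < (2 ((√((p−1)b² − 2b + 2) + 1/2)/√3)³)^{t/3}`.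
The pure-real lemma `linear_absurd` kills this with rational data `(r, s₀, κ₀)`:
`R = (p − 1)^{1/t} ≥ r`, `√(p − 1) ≤ s₀`, `27 κ₀⁶ ≥ 4` (so `2/(3√3) ≤ κ₀³`) give
`(p − 1)(b − 1)^t ≤ floor < cap^{t/3} ≤ (κ₀ (s₀ b + 1/2))^t`, i.e. `r (b − 1) < κ₀ (s₀ b + 1/2)`,
contradicting the LINEAR CERTIFICATE `r + κ₀/2 ≤ (r − κ₀ s₀) · B₀` as soon as `b ≥ B₀`
(`B₀ = p² + p + 1 ≤ b` for `l ≥ 2`, `sq_succ_le_b`).  With `κ₀ = 291/400` the certificate holds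
(checked by `norm_num`) for
`(p, ε) = (11, 7/10), (13, 2/3), (17, 4/7), (19, 6/11), (23, 1/2), (29, 9/20), (31, 9/20),
(37, 5/12), (41, 2/5), (43, 2/5)`, each in every dimension `m = 1 + l ≥ 3`
(`no_levelOne_witness_allDim_*`, packaged against the crux clause verbatim in
`no_crux_instance_allDim_*`).  The continuous reach of the certificate is
`ε_F(p) ≈ 0.735, 0.671, 0.587, 0.558, 0.515, 0.470, 0.459, 0.431, 0.416, 0.410` at these primes
(vs `ε_N(p) ≈ 0.684, 0.625, 0.550, 0.524, 0.484, 0.443, 0.433, 0.407, 0.394, 0.388`); for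
`p → ∞` both behave like `c/log p` and the gain vanishes, so larger primes are left to
`no_levelOne_witness_neumann_eps`.  For `m = 3` alone the cells files `LevelOneEpsilonCells*`
reach further at `p = 11, 13` (`3/4`, resp. the same `2/3` with `B = 183`).

What this is NOT: it says nothing about levels `k ≥ 2`, nothing about `ε` above the listed
windows, and nothing about the summit.  VALUE = THEOREM (negative, uniform in the dimension).
-/

set_option linter.dupNamespace false

noncomputable section

open scoped BigOperators Classical Matrix
open Module (finrank)

namespace Summit.MatrixMultiplication.MatrixMultiplication.Theorems.SubgroupIdentityDesigns.Negative
namespace LevelOneEpsilonUniform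

open Literature.Barriers.MatrixMultiplication (SubgroupTPP)
open Summit.MatrixMultiplication.MatrixMultiplication.Theorems.LieRankDesigns.Negative
open Summit.MatrixMultiplication.MatrixMultiplication.Theorems.LevelOneGL2Designs.Negative
open LevelOneFloorAll (finrank_le_formula_nat sq_succ_le_b)
open WitnessNeumannCounts (crux_volume_law)
open LevelOneEpsilonFloor (floor_exp)
open LevelOneNeumannSqueeze (law_ceiling ceiling_mono)
open Literature.Barriers.RiemannHypothesis (le_rpow_of_pow_le)

/-! ## The pure-real certificate -/

/-- `2/(3√3) ≤ κ₀³` from `4 ≤ 27 κ₀⁶`, in the form `2 ≤ κ₀³ (√3)³`. -/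
theorem two_le_kappa_cube {κ₀ : ℝ} (hκ0 : 0 ≤ κ₀) (hκ : 4 ≤ 27 * κ₀ ^ 6) :
    2 ≤ κ₀ ^ 3 * Real.sqrt 3 ^ 3 := by
  have h3 : Real.sqrt 3 ^ 2 = 3 := Real.sq_sqrt (by norm_num)
  have hz0 : 0 ≤ κ₀ ^ 3 * Real.sqrt 3 ^ 3 := by positivity
  have hsq : (κ₀ ^ 3 * Real.sqrt 3 ^ 3) ^ 2 = 27 * κ₀ ^ 6 := by
    have h6 : Real.sqrt 3 ^ 6 = 27 := by
      rw [show (6 : ℕ) = 2 * 3 by norm_num, pow_mul, h3]; norm_num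
    calc (κ₀ ^ 3 * Real.sqrt 3 ^ 3) ^ 2 = κ₀ ^ 6 * Real.sqrt 3 ^ 6 := by ring
      _ = 27 * κ₀ ^ 6 := by rw [h6]; ring
  nlinarith [hz0, hsq]

/-- The cap is at most a cube that is LINEAR in `B`:
`2 ((√((p−1)B² − 2B + 2) + 1/2)/√3)³ ≤ (κ₀ (s₀ B + 1/2))³` when `p − 1 ≤ s₀²`, `27 κ₀⁶ ≥ 4`. -/
theorem cap_le_cube {P1 B s₀ κ₀ : ℝ} (hB : 1 ≤ B) (hs0 : 0 ≤ s₀) (hs : P1 ≤ s₀ ^ 2)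
    (hκ0 : 0 ≤ κ₀) (hκ : 4 ≤ 27 * κ₀ ^ 6) :
    2 * ((Real.sqrt (P1 * B ^ 2 - 2 * B + 2) + 1 / 2) / Real.sqrt 3) ^ 3 ≤
      (κ₀ * (s₀ * B + 1 / 2)) ^ 3 := by
  have hsq : Real.sqrt (P1 * B ^ 2 - 2 * B + 2) ≤ s₀ * B := by
    have h1 : P1 * B ^ 2 - 2 * B + 2 ≤ (s₀ * B) ^ 2 := by
      nlinarith [mul_le_mul_of_nonneg_right hs (sq_nonneg B)]
    calc Real.sqrt (P1 * B ^ 2 - 2 * B + 2) ≤ Real.sqrt ((s₀ * B) ^ 2) := Real.sqrt_le_sqrt h1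
      _ = s₀ * B := Real.sqrt_sq (by positivity)
  have h3pos : 0 < Real.sqrt 3 := Real.sqrt_pos.2 (by norm_num)
  have hY0 : 0 ≤ s₀ * B + 1 / 2 := by positivity
  have hdiv : (Real.sqrt (P1 * B ^ 2 - 2 * B + 2) + 1 / 2) / Real.sqrt 3 ≤
      (s₀ * B + 1 / 2) / Real.sqrt 3 :=
    div_le_div_of_nonneg_right (by linarith) h3pos.le
  have hpow : ((Real.sqrt (P1 * B ^ 2 - 2 * B + 2) + 1 / 2) / Real.sqrt 3) ^ 3 ≤
      ((s₀ * B + 1 / 2) / Real.sqrt 3) ^ 3 :=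
    pow_le_pow_left₀ (by positivity) hdiv 3
  have hk := two_le_kappa_cube hκ0 hκ
  have hY3 : 0 ≤ (s₀ * B + 1 / 2) ^ 3 := pow_nonneg hY0 3
  calc 2 * ((Real.sqrt (P1 * B ^ 2 - 2 * B + 2) + 1 / 2) / Real.sqrt 3) ^ 3
      ≤ 2 * ((s₀ * B + 1 / 2) / Real.sqrt 3) ^ 3 := by linarith [hpow]
    _ = 2 * (s₀ * B + 1 / 2) ^ 3 / Real.sqrt 3 ^ 3 := by rw [div_pow]; ring
    _ ≤ κ₀ ^ 3 * (s₀ * B + 1 / 2) ^ 3 := by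
        rw [div_le_iff₀ (by positivity)]
        nlinarith [mul_le_mul_of_nonneg_left hk hY3]
    _ = (κ₀ * (s₀ * B + 1 / 2)) ^ 3 := by ring

/-- **THE LINEAR CERTIFICATE LEMMA** (pure real analysis).  If
`1 + (B − 1)^t + pm2 · B^t < (2 ((√(P1 B² − 2B + 2) + 1/2)/√3)³)^{t/3}` with `pm2 = P1 − 1 ≥ 0`,
`t > 0`, `R ≥ 0`, `R^t = P1`, `r ≤ R`, `P1 ≤ s₀²`, `27 κ₀⁶ ≥ 4`, `κ₀ s₀ ≤ r` and the certificate
`r + κ₀/2 ≤ (r − κ₀ s₀) B₀` holds at some `1 ≤ B₀ ≤ B`, contradiction. -/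
theorem linear_absurd {P1 pm2 B B₀ t R r s₀ κ₀ : ℝ} (ht : 0 < t) (hB0 : B₀ ≤ B) (hB1 : 1 ≤ B₀)
    (hP : pm2 = P1 - 1) (hpm2 : 0 ≤ pm2) (hR0 : 0 ≤ R) (hRt : R ^ t = P1)
    (hrR : r ≤ R) (hs0 : 0 ≤ s₀) (hs : P1 ≤ s₀ ^ 2) (hκ0 : 0 ≤ κ₀) (hκ : 4 ≤ 27 * κ₀ ^ 6)
    (hA : κ₀ * s₀ ≤ r) (hcert : r + κ₀ / 2 ≤ (r - κ₀ * s₀) * B₀)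
    (hM : 1 + (B - 1) ^ t + pm2 * B ^ t <
      (2 * ((Real.sqrt (P1 * B ^ 2 - 2 * B + 2) + 1 / 2) / Real.sqrt 3) ^ 3) ^ (t / 3)) :
    False := by
  have hB : 1 ≤ B := hB1.trans hB0
  have hB' : 0 ≤ B - 1 := by linarith
  have hY0 : 0 ≤ κ₀ * (s₀ * B + 1 / 2) := by positivity
  have hcap := cap_le_cube (P1 := P1) hB hs0 hs hκ0 hκ
  have hcap0 : 0 ≤ 2 * ((Real.sqrt (P1 * B ^ 2 - 2 * B + 2) + 1 / 2) / Real.sqrt 3) ^ 3 := by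
    positivity
  -- cap^{t/3} ≤ (κ₀ Y)^t
  have h1 : (2 * ((Real.sqrt (P1 * B ^ 2 - 2 * B + 2) + 1 / 2) / Real.sqrt 3) ^ 3) ^ (t / 3) ≤
      ((κ₀ * (s₀ * B + 1 / 2)) ^ 3) ^ (t / 3) :=
    Real.rpow_le_rpow hcap0 hcap (by positivity)
  have h2 : ((κ₀ * (s₀ * B + 1 / 2)) ^ 3) ^ (t / 3) = (κ₀ * (s₀ * B + 1 / 2)) ^ t := by
    rw [show ((κ₀ * (s₀ * B + 1 / 2)) ^ 3 : ℝ) = (κ₀ * (s₀ * B + 1 / 2)) ^ (3 : ℝ) by norm_cast,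
      ← Real.rpow_mul hY0]
    congr 1; ring
  -- floor ≥ (R (B − 1))^t
  have h3 : (B - 1) ^ t ≤ B ^ t := Real.rpow_le_rpow hB' (by linarith) ht.le
  have h4 : (R * (B - 1)) ^ t = P1 * (B - 1) ^ t := by rw [Real.mul_rpow hR0 hB', hRt]
  have h0t : 0 ≤ (B - 1) ^ t := Real.rpow_nonneg hB' t
  have h5 : (R * (B - 1)) ^ t < (κ₀ * (s₀ * B + 1 / 2)) ^ t := by
    calc (R * (B - 1)) ^ t = (B - 1) ^ t + pm2 * (B - 1) ^ t := by rw [h4, hP]; ring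
      _ ≤ (B - 1) ^ t + pm2 * B ^ t := by nlinarith [mul_le_mul_of_nonneg_left h3 hpm2]
      _ < 1 + (B - 1) ^ t + pm2 * B ^ t := by linarith
      _ < (2 * ((Real.sqrt (P1 * B ^ 2 - 2 * B + 2) + 1 / 2) / Real.sqrt 3) ^ 3) ^ (t / 3) := hM
      _ ≤ (κ₀ * (s₀ * B + 1 / 2)) ^ t := h1.trans_eq h2
  -- monotonicity of `x ↦ x^t` backwards
  have h6 : R * (B - 1) < κ₀ * (s₀ * B + 1 / 2) := by
    refine not_le.mp fun hle => ?_
    have := Real.rpow_le_rpow hY0 hle ht.le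
    linarith
  -- the linear certificate
  have h7 : r * (B - 1) ≤ R * (B - 1) := mul_le_mul_of_nonneg_right hrR hB'
  have h8 : (r - κ₀ * s₀) * B₀ ≤ (r - κ₀ * s₀) * B :=
    mul_le_mul_of_nonneg_left hB0 (by linarith)
  nlinarith [h6, h7, h8, hcert]


/-! ## The witness-level statements -/

variable {p : ℕ} [hp : Fact p.Prime] {l : ℕ}

/-- **UNIFORM MASTER INEQUALITY OF A LEVEL-ONE WITNESS** (`b = (p^{1+l} − 1)/(p − 1)`, any real
`t ≥ 2 + ε`): `1 + (b − 1)^t + (p − 2) b^t < (2 ((√((p − 1) b² − 2 b + 2) + 1/2)/√3)³)^{t/3}`. -/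
theorem uniform_master (hl : 1 ≤ l) {ε t : ℝ} (hε : -2 < ε) (hεt : 2 + ε ≤ t)
    {H₁ H₂ H₃ : Subgroup (GLm p (1 + l))} (htpp : SubgroupTPP H₁ H₂ H₃)
    (hdes : ∃ c : Mat p (1 + l) → ℂ, (∀ M, 1 < M.rank → c M = 0) ∧
      (∑ M, c M * ZMod.stdAddChar (Matrix.trace (M * ((1 : GLm p (1 + l)) : Mat p (1 + l))))) = 1 ∧
      ∀ a ∈ H₁, ∀ b ∈ H₂, ∀ g ∈ H₃, a * b * g ≠ 1 →
        (∑ M, c M * ZMod.stdAddChar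
          (Matrix.trace (M * ((a * b * g : GLm p (1 + l)) : Mat p (1 + l))))) = 0)
    (hlt : budget p (1 + l) 1 (2 + ε) <
      ((Nat.card H₁ * Nat.card H₂ * Nat.card H₃ : ℕ) : ℝ) ^ ((2 + ε) / 3)) :
    1 + ((((p ^ (1 + l) - 1) / (p - 1) : ℕ) : ℝ) - 1) ^ t +
        ((p : ℝ) - 2) * (((p ^ (1 + l) - 1) / (p - 1) : ℕ) : ℝ) ^ t <
      (2 * ((Real.sqrt (((p : ℝ) - 1) * (((p ^ (1 + l) - 1) / (p - 1) : ℕ) : ℝ) ^ 2 -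
          2 * (((p ^ (1 + l) - 1) / (p - 1) : ℕ) : ℝ) + 2) + 1 / 2) / Real.sqrt 3) ^ 3) ^
        (t / 3) := by
  obtain ⟨u, hu1, -, -, -, h5, h6⟩ := crux_volume_law (k := 1) htpp hdes
  have hfl := floor_exp hl hε hεt hlt
  have hDn := finrank_le_formula_nat (p := p) (l := l)
  have hp1 : 1 ≤ p := hp.out.one_le
  set b : ℕ := (p ^ (1 + l) - 1) / (p - 1) with hb_def
  set V : ℕ := Nat.card H₁ * Nat.card H₂ * Nat.card H₃ with hV_def
  set D : ℕ := finrank ℂ (levelSubmodule p (1 + l) 1) with hD_def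
  have hV0 : (0 : ℝ) ≤ (V : ℝ) := Nat.cast_nonneg _
  have hD0 : (0 : ℝ) ≤ (D : ℝ) := Nat.cast_nonneg _
  have hu0 : (0 : ℝ) ≤ (u : ℝ) := Nat.cast_nonneg _
  have h5R : ((u : ℝ)) ^ 2 ≤ (D : ℝ) := by
    have h := (Nat.cast_le (α := ℝ)).mpr h5
    push_cast at h
    nlinarith [h]
  have h6R : (V : ℝ) ≤ (u : ℝ) * (D : ℝ) - (u : ℝ) ^ 3 + (u : ℝ) ^ 2 := by
    have h := (Nat.cast_le (α := ℝ)).mpr h6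
    push_cast [Nat.cast_sub hu1] at h
    nlinarith [h]
  have hDm : (D : ℝ) ≤ ((p : ℝ) - 1) * (b : ℝ) ^ 2 - 2 * (b : ℝ) + 2 := by
    have h := (Nat.cast_le (α := ℝ)).mpr hDn
    push_cast [Nat.cast_sub hp1] at h
    linarith
  have hVC : (V : ℝ) ≤
      2 * ((Real.sqrt (((p : ℝ) - 1) * (b : ℝ) ^ 2 - 2 * (b : ℝ) + 2) + 1 / 2) / Real.sqrt 3) ^ 3 :=
    (h6R.trans (law_ceiling hu0 hD0 h5R)).trans (ceiling_mono hDm)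
  have hup := Real.rpow_le_rpow hV0 hVC (by linarith : (0 : ℝ) ≤ t / 3)
  exact hfl.trans_le hup

/-- **THE CERTIFIED VERDICT, generic form.**  `l ≥ 2`, `2 + ε ≤ k/n`, rational data `r, s₀` with
`r^k ≤ (p − 1)^n`, `p − 1 ≤ s₀²`, `κ₀ s₀ ≤ r` and `r + κ₀/2 ≤ (r − κ₀ s₀)(p² + p + 1)`
(`κ₀ = 291/400`): no level-one witness in `GL_{1+l}(𝔽_p)` at exponent `ε`. -/
theorem no_levelOne_witness_cert (hl : 2 ≤ l) {ε : ℝ} (hε : -2 < ε) {k n : ℕ} (hk : k ≠ 0)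
    (hn : n ≠ 0) (hεt : 2 + ε ≤ (k : ℝ) / n) {r s₀ : ℝ} (hr0 : 0 ≤ r) (hs0 : 0 ≤ s₀)
    (hr : r ^ k ≤ ((p : ℝ) - 1) ^ n) (hs : (p : ℝ) - 1 ≤ s₀ ^ 2)
    (hA : 291 / 400 * s₀ ≤ r)
    (hcert : r + 291 / 400 / 2 ≤ (r - 291 / 400 * s₀) * ((p : ℝ) ^ 2 + p + 1))
    {H₁ H₂ H₃ : Subgroup (GLm p (1 + l))} (htpp : SubgroupTPP H₁ H₂ H₃)
    (hdes : ∃ c : Mat p (1 + l) → ℂ, (∀ M, 1 < M.rank → c M = 0) ∧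
      (∑ M, c M * ZMod.stdAddChar (Matrix.trace (M * ((1 : GLm p (1 + l)) : Mat p (1 + l))))) = 1 ∧
      ∀ a ∈ H₁, ∀ b ∈ H₂, ∀ g ∈ H₃, a * b * g ≠ 1 →
        (∑ M, c M * ZMod.stdAddChar
          (Matrix.trace (M * ((a * b * g : GLm p (1 + l)) : Mat p (1 + l))))) = 0) :
    ¬ budget p (1 + l) 1 (2 + ε) <
      ((Nat.card H₁ * Nat.card H₂ * Nat.card H₃ : ℕ) : ℝ) ^ ((2 + ε) / 3) := by
  intro hlt
  have hp2 : (2 : ℝ) ≤ p := by exact_mod_cast hp.out.two_le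
  have hk0 : (0 : ℝ) < k := by exact_mod_cast Nat.pos_of_ne_zero hk
  have hn0 : (0 : ℝ) < n := by exact_mod_cast Nat.pos_of_ne_zero hn
  have hkne : (k : ℝ) ≠ 0 := hk0.ne'
  have hnne : (n : ℝ) ≠ 0 := hn0.ne'
  have ht0 : (0 : ℝ) < (k : ℝ) / n := div_pos hk0 hn0
  have hM := uniform_master (by omega) hε hεt htpp hdes hlt
  have hB0 : (p : ℝ) ^ 2 + p + 1 ≤ (((p ^ (1 + l) - 1) / (p - 1) : ℕ) : ℝ) := by
    exact_mod_cast sq_succ_le_b hl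
  have hP1 : (0 : ℝ) ≤ (p : ℝ) - 1 := by linarith
  have hRt : (((p : ℝ) - 1) ^ ((n : ℝ) / k)) ^ ((k : ℝ) / n) = (p : ℝ) - 1 := by
    rw [← Real.rpow_mul hP1, show (n : ℝ) / k * ((k : ℝ) / n) = 1 by field_simp, Real.rpow_one]
  have hrR : r ≤ ((p : ℝ) - 1) ^ ((n : ℝ) / k) :=
    le_rpow_of_pow_le hP1 hr0 hk (by field_simp) hr
  exact linear_absurd (pm2 := (p : ℝ) - 2) ht0 hB0 (by nlinarith) (by ring) (by linarith)
    (Real.rpow_nonneg hP1 _) hRt hrR hs0 hs (by norm_num) (by norm_num) hA hcert hM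

/-- **THE TEN CERTIFIED CELLS, every dimension `m = 1 + l ≥ 3`.**  No level-one witness for
`(p, ε ≤ ·) = (11, 7/10), (13, 2/3), (17, 4/7), (19, 6/11), (23, 1/2), (29, 9/20), (31, 9/20),
(37, 5/12), (41, 2/5), (43, 2/5)` — each above the squeeze threshold `ε_N(p)`. -/
theorem no_levelOne_witness_allDim (hl : 2 ≤ l) {ε : ℝ} (hε : -2 < ε)
    (hcell : (p = 11 ∧ ε ≤ 7 / 10) ∨
      (p = 13 ∧ ε ≤ 2 / 3) ∨
      (p = 17 ∧ ε ≤ 4 / 7) ∨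
      (p = 19 ∧ ε ≤ 6 / 11) ∨
      (p = 23 ∧ ε ≤ 1 / 2) ∨
      (p = 29 ∧ ε ≤ 9 / 20) ∨
      (p = 31 ∧ ε ≤ 9 / 20) ∨
      (p = 37 ∧ ε ≤ 5 / 12) ∨
      (p = 41 ∧ ε ≤ 2 / 5) ∨
      (p = 43 ∧ ε ≤ 2 / 5))
    {H₁ H₂ H₃ : Subgroup (GLm p (1 + l))} (htpp : SubgroupTPP H₁ H₂ H₃)
    (hdes : ∃ c : Mat p (1 + l) → ℂ, (∀ M, 1 < M.rank → c M = 0) ∧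
      (∑ M, c M * ZMod.stdAddChar (Matrix.trace (M * ((1 : GLm p (1 + l)) : Mat p (1 + l))))) = 1 ∧
      ∀ a ∈ H₁, ∀ b ∈ H₂, ∀ g ∈ H₃, a * b * g ≠ 1 →
        (∑ M, c M * ZMod.stdAddChar
          (Matrix.trace (M * ((a * b * g : GLm p (1 + l)) : Mat p (1 + l))))) = 0) :
    ¬ budget p (1 + l) 1 (2 + ε) <
      ((Nat.card H₁ * Nat.card H₂ * Nat.card H₃ : ℕ) : ℝ) ^ ((2 + ε) / 3) := by
  rcases hcell with ⟨hP, hE⟩ | ⟨hP, hE⟩ | ⟨hP, hE⟩ | ⟨hP, hE⟩ | ⟨hP, hE⟩ | ⟨hP, hE⟩ | ⟨hP, hE⟩ |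
    ⟨hP, hE⟩ | ⟨hP, hE⟩ | ⟨hP, hE⟩
  · subst hP
    exact no_levelOne_witness_cert (k := 27) (n := 10)
      (r := 11731 / 5000) (s₀ := 31623 / 10000) hl hε
      (by norm_num) (by norm_num) (by norm_num; linarith [hE]) (by norm_num) (by norm_num)
      (by norm_num) (by norm_num) (by norm_num) (by norm_num) htpp hdes
  · subst hP
    exact no_levelOne_witness_cert (k := 8) (n := 3) (r := 25391 / 10000) (s₀ := 17321 / 5000) hl hε
      (by norm_num) (by norm_num) (by norm_num; linarith [hE]) (by norm_num) (by norm_num)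
      (by norm_num) (by norm_num) (by norm_num) (by norm_num) htpp hdes
  · subst hP
    exact no_levelOne_witness_cert (k := 18) (n := 7) (r := 14697 / 5000) (s₀ := 4) hl hε
      (by norm_num) (by norm_num) (by norm_num; linarith [hE]) (by norm_num) (by norm_num)
      (by norm_num) (by norm_num) (by norm_num) (by norm_num) htpp hdes
  · subst hP
    exact no_levelOne_witness_cert (k := 28) (n := 11)
      (r := 31127 / 10000) (s₀ := 42427 / 10000) hl hε
      (by norm_num) (by norm_num) (by norm_num; linarith [hE]) (by norm_num) (by norm_num)
      (by norm_num) (by norm_num) (by norm_num) (by norm_num) htpp hdes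
  · subst hP
    exact no_levelOne_witness_cert (k := 5) (n := 2) (r := 2152 / 625) (s₀ := 9381 / 2000) hl hε
      (by norm_num) (by norm_num) (by norm_num; linarith [hE]) (by norm_num) (by norm_num)
      (by norm_num) (by norm_num) (by norm_num) (by norm_num) htpp hdes
  · subst hP
    exact no_levelOne_witness_cert (k := 49) (n := 20) (r := 7793 / 2000) (s₀ := 13229 / 2500) hl hε
      (by norm_num) (by norm_num) (by norm_num; linarith [hE]) (by norm_num) (by norm_num)
      (by norm_num) (by norm_num) (by norm_num) (by norm_num) htpp hdes
  · subst hP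
    exact no_levelOne_witness_cert (k := 49) (n := 20)
      (r := 20039 / 5000) (s₀ := 54773 / 10000) hl hε
      (by norm_num) (by norm_num) (by norm_num; linarith [hE]) (by norm_num) (by norm_num)
      (by norm_num) (by norm_num) (by norm_num) (by norm_num) htpp hdes
  · subst hP
    exact no_levelOne_witness_cert (k := 29) (n := 12) (r := 22027 / 5000) (s₀ := 6) hl hε
      (by norm_num) (by norm_num) (by norm_num; linarith [hE]) (by norm_num) (by norm_num)
      (by norm_num) (by norm_num) (by norm_num) (by norm_num) htpp hdes
  · subst hP
    exact no_levelOne_witness_cert (k := 12) (n := 5)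
      (r := 46507 / 10000) (s₀ := 31623 / 5000) hl hε
      (by norm_num) (by norm_num) (by norm_num; linarith [hE]) (by norm_num) (by norm_num)
      (by norm_num) (by norm_num) (by norm_num) (by norm_num) htpp hdes
  · subst hP
    exact no_levelOne_witness_cert (k := 12) (n := 5) (r := 23731 / 5000) (s₀ := 8101 / 1250) hl hε
      (by norm_num) (by norm_num) (by norm_num; linarith [hE]) (by norm_num) (by norm_num)
      (by norm_num) (by norm_num) (by norm_num) (by norm_num) htpp hdes

/-- The same ten cells packaged against the crux clause verbatim, over all dimensions `m ≥ 3`: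
`SubgroupIdentityDesigns` has NO instance with `k = 1`, `m ≥ 3` and `(p, ε)` in a listed cell. -/
theorem no_crux_instance_allDim {ε : ℝ} (hε : -2 < ε)
    (hcell : (p = 11 ∧ ε ≤ 7 / 10) ∨
      (p = 13 ∧ ε ≤ 2 / 3) ∨
      (p = 17 ∧ ε ≤ 4 / 7) ∨
      (p = 19 ∧ ε ≤ 6 / 11) ∨
      (p = 23 ∧ ε ≤ 1 / 2) ∨
      (p = 29 ∧ ε ≤ 9 / 20) ∨
      (p = 31 ∧ ε ≤ 9 / 20) ∨
      (p = 37 ∧ ε ≤ 5 / 12) ∨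
      (p = 41 ∧ ε ≤ 2 / 5) ∨
      (p = 43 ∧ ε ≤ 2 / 5)) :
    ¬ ∃ (m : ℕ) (_ : 3 ≤ m)
      (H₁ H₂ H₃ : Subgroup (Matrix.GeneralLinearGroup (Fin m) (ZMod p))),
      Literature.Barriers.MatrixMultiplication.SubgroupTPP H₁ H₂ H₃ ∧
      (∃ c : Matrix (Fin m) (Fin m) (ZMod p) → ℂ, (∀ M, 1 < M.rank → c M = 0) ∧
        (∑ M : Matrix (Fin m) (Fin m) (ZMod p), c M * ZMod.stdAddChar
          (Matrix.trace (M * ((1 : Matrix.GeneralLinearGroup (Fin m) (ZMod p)) :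
            Matrix (Fin m) (Fin m) (ZMod p))))) = 1 ∧
        ∀ a ∈ H₁, ∀ b ∈ H₂, ∀ g ∈ H₃, a * b * g ≠ 1 →
          (∑ M : Matrix (Fin m) (Fin m) (ZMod p), c M * ZMod.stdAddChar
            (Matrix.trace (M * ((a * b * g : Matrix.GeneralLinearGroup (Fin m) (ZMod p)) :
              Matrix (Fin m) (Fin m) (ZMod p))))) = 0) ∧
      (∑ᶠ χ ∈ Literature.RepresentationTheory.FiniteGroups.irrChars
          (Matrix.GeneralLinearGroup (Fin m) (ZMod p)) ∩
          {f | ∃ c : Matrix (Fin m) (Fin m) (ZMod p) → ℂ, (∀ M, 1 < M.rank → c M = 0) ∧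
            ∀ g : Matrix.GeneralLinearGroup (Fin m) (ZMod p), f g =
              ∑ M : Matrix (Fin m) (Fin m) (ZMod p), c M * ZMod.stdAddChar
                (Matrix.trace (M * (g : Matrix (Fin m) (Fin m) (ZMod p))))},
        (χ 1).re ^ (2 + ε)) <
        ((Nat.card H₁ * Nat.card H₂ * Nat.card H₃ : ℕ) : ℝ) ^ ((2 + ε) / 3) := by
  rintro ⟨m, hm, H₁, H₂, H₃, htpp, hdesign, hlt⟩
  obtain ⟨l, rfl⟩ : ∃ l, m = 1 + l := ⟨m - 1, by omega⟩
  exact no_levelOne_witness_allDim (by omega) hε hcell htpp hdesign hlt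

end LevelOneEpsilonUniform
end Summit.MatrixMultiplication.MatrixMultiplication.Theorems.SubgroupIdentityDesigns.Negative
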